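import Mathlib.Analysis.SpecialFunctions.Exponential
import Mathlib.Analysis.SpecialFunctions.Log.Basic
import Literature.MathematicalPhysics.QuantumLattice.GrassmannGaussianChargeRule
import Literature.MathematicalPhysics.QuantumFieldTheory.Dimock2011to13.QED3FermionPartialIntegral
import Literature.MathematicalPhysics.QuantumFieldTheory.Dimock2011to13.QED3MultiweightNorm
import Literature.MathematicalPhysics.QuantumFieldTheory.Dimock2011to13.QED3SmallFieldFermionPerturbation
import Literature.MathematicalPhysics.QuantumFieldTheory.Dimock2011to13.QED3GrassmannMultiweightNormedAlgebra
import Literature.MathematicalPhysics.QuantumFieldTheory.Dimock2011to13.QED3BoundaryActivitySum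
import HarnessLib

/-!
# Dimock, *Ultraviolet stability for QED in d = 3*, §4.2.1 «fermion integral — large fields region», LEMMA 20 (449)
# «`|J_{K,Π}| ≤ exp(CΣ_{j=0}^{K}|δΩ_j^{(j)}| + Σ_{j=1}^{K}|δΛ^{(j)}_{j−1}|)`»: the INTEGRATION STEP (452)∕(455) — one block of
# fermi fields is integrated out at weight `1` against the unit Gaussian, the remaining fields are scaled by `L`, and one
# pays `L^{|δΩ|}e^{|δΩ|} = e^{C|δΩ|}` — PROVED in the mixed∕multiscale Grassmann norms of App. B, with the iteration
# (456) and the assembly of (449) from LEMMA 19's (435) and (457)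

statement-level skeleton of published theorems with citation tags; proofs where landed; nothing here is a claim about the Yang–Mills mass gap

**Citation header (reproduction of PUBLISHED work).** J. Dimock, *Ultraviolet stability for QED in d = 3*, Ann. Henri
Poincaré **23** (2022) 2113–2205 (= arXiv:2009.01156v2) [Dimock2022UVStabilityQED3], §4.2.1 LEMMA 20 (449) p.60 L96–107
with its proof (450)–(457) p.61 L1 – p.62 L38 (and LEMMA 18 (427)–(428) p.58 L24–54, LEMMA 19 (435) p.59 L22–35 as the
objects∕input it quotes), App. B «Norms» (528)–(536) p.73 L25 – p.74 L65 (single, pair and multiscale norms; «These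
can also be combined for mixed versions») — loci of the held arXiv text layer `paper:arxiv-2009.01156`.  J. Dimock,
*Quantum electrodynamics on the 3-torus. I*, arXiv:math-ph/0210020 [Dimock2002QED3TorusI], App. B LEMMA 21 (311) and
LEMMA 22 (317) p.64 L1–30 (Gaussian integration of the primed fields with the unprimed fields as spectators: in the tree
as `QED3TorusI.partialExpect`, `hNorm_partialExpect_le`, `norm_gaussExpect_grassmannBasis_le_pow`).  Writer seat p11
(literature-prover-lit-balaban-p11-g26-0), YM LIT SWEEP item (c) D8 (row C08; zero weight for the YM-INPRINT tokens).
Builds on the tree's `QED3MultiweightNorm` (`hNormW w` = the weight-per-generator norm of (536)), `QED3FermionPartialIntegral`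
(two blocks of generators `ι₁ ⊕ₗ ι₂`, `partialExpect`, `mapSnd`), `QED3FermionNorm` (`subst`, LEMMA 19∕20),
`QED3SmallFieldFermionPerturbation` (`hNorm_quadratic_le_of_rowsum`) and `QuantumLattice` (`grassmannExp`,
`isNilpotent_quadratic`).

**The printed text (verbatim, text layer).**  p.60 L96–107: *"Lemma 20. `|J_{K,Π}| ≤ exp(CΣ_{j=0}^{K}|δΩ_j^{(j)}| +
Σ_{j=1}^{K}|δΛ^{(j)}_{j−1}|)` (449)"*.  p.61 L26–52 (the first step): *"In the `Ψ_K` integral we change to `Ψ_K = Ψ′_{K,L}`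
with `Ψ′_K` back on `T⁰_{N−K}`. Then `DΨ_{K,LΩ_K} = L^{|Ω_K^{(K)}|}DΨ′_{K,Ω_K}`. To facilitate estimates we artificially
introduce a Gaussian integral by `DΨ′_{K,Ω_K} = e^{⟨Ψ̄′_K,Ψ′_K⟩_{Ω_K}}dμ_I(Ψ′_K)`. Then we have `F_{K−1}(Ψ_{K−1,LΩ},
W_{K−1,LΠ}) = L^{|Ω_K^{(K)}|}∫F′_{K,L}(Ψ_{K−1,LΩ}, Ψ′_{K,Ω_K}, W_{K−2,LΠ}, W_{K−1,LΩ_K})e^{⟨Ψ̄′_K,Ψ′_K⟩_{Ω_K}}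
dμ_{I,Ω_K}(Ψ′_K)dμ_{I,LΩ_K}(W_{K−1})` (451) where the prime means the scaling in `F′_{K,L}` is in all fields except
`Ψ′_{K,Ω_K}` which is already scaled. In general on a unit lattice `|∫f(Ψ)dμ_I(Ψ)| ≤ ‖f‖₁`, see the appendix in [30]. So
with `I_K = (L^K,…,1)` we have `(LI_{K−1},1) = I_K` and hence `‖F_{K−1}‖_{I_{K−1},LI_{K−1}} ≤
L^{|Ω_K|}‖F′_{K,L}e^{⟨Ψ̄′_K,Ψ′_K⟩_{Ω_K}}‖_{I_{K−1},1,LI_{K−1},1} ≤ L^{|Ω_K^{(K)}|}‖F′_{K,L}‖_{I_{K−1},1,I_K}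
exp(‖⟨Ψ̄′_K,Ψ′_K⟩_{Ω_K}‖₁) ≤ L^{|Ω_K^{(K)}|}‖F_K‖_{LI_{K−1},1,LI_K}exp(|Ω_K^{(K)}|) = exp(C|Ω_K^{(K)}|)‖F_K‖_{I_K,LI_K}`
(452)"*.  p.62 L1–30 (the general step and the iteration): *"Now we estimate as before with `(LI_k,1) = I_{k+1}`
`‖F_k‖_{I_k,LI_k} ≤ L^{|δΩ^{(k+1)}_{k+1}|}‖F′_{k+1,L}exp(−⟨Ψ̄′_{k+1},Ψ′_{k+1}⟩_{δΩ_{k+1}})‖_{I_k,1,LI_k,1} ≤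
L^{|δΩ^{(k+1)}_{k+1}|}‖F′_{k+1,L}‖_{I_k,1,I_{k+1}}exp(‖⟨Ψ̄′_{k+1},Ψ′_{k+1}⟩_{δΩ_{k+1}}‖₁) ≤
L^{|δΩ^{(k+1)}_{k+1}|}‖F_{k+1}‖_{LI_k,1,LI_{k+1}}exp(|δΩ^{(k+1)}_{k+1}|) ≤ ‖F_{k+1}‖_{I_{k+1},LI_{k+1}}exp(C|δΩ^{(k+1)}_{k+1}|)`
(455) Iterating this inequality and inserting the bound (435) on `‖F_{K,Π}‖_{I_K,LI_K}` we have `‖F_0‖_{I_K} ≤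
exp(CΣ_{j=1}^{K−1}|δΩ_j^{(j)}|)‖F_K‖_{I_K,LI_K} ≤ exp(CΣ_{j=1}^{K}|δΩ_j^{(j)}| + Σ_{j=1}^{K}|δΛ^{(j)}_{j−1}|)` (456)"*;
p.62 L31–38: *"The representation of `J_{K,Π}` in terms of `F_{0,Π}` is `J_{K,Π} = ∫F_0(Ψ_{0,L^KΩ^c_1})DΨ_{0,L^KΩ^c_1}`
(457) This is also estimated as a Gaussian integral which gives an additional factor `e^{|L^KΩ^c_1|} = e^{|Ω^c_1|} ≡
e^{|δΩ_0^{(0)}|}`. This completes the proof."*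

**What is formalized (kernel-checked, zero `sorry`, no named facts).**  Two blocks of generators `ι₁ ⊕ₗ ι₂` (the tree's
`QED3FermionPartialIntegral`): block `ι₁` = all fields that are kept (`Ψ_{k,Ω(k)}`, `W_{k,Π(k)}` …), block `ι₂` = the
fields `Ψ̄′_{k+1}, Ψ′_{k+1}` on `δΩ_{k+1}` that are integrated out; weights per generator (`QED3MultiweightNorm.hNormW`).
* §1 **mixed weights and D12 LEMMA 22 for them** («These can also be combined for mixed versions», App. B p.73 L27–28):
  `sumWeight w₁ w₂` (weight `w₁` on block `ι₁`, `w₂` on block `ι₂`), `monoWeight_sumWeight` (the weight of a two-block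
  monomial is the product over the blocks); **`hNormW_partialExpect_le`** — if `|μ(θ′_T)| ≤ Π_{ξ∈T}w₂(ξ)` and
  `0 ≤ w₁′ ≤ w₁` then `‖∫F dμ(Ψ′)‖_{w₁′} ≤ ‖F‖_{(w₁,w₂)}` (the tree's `hNorm_partialExpect_le` is the one-weight case);
  `hNormW_partialGaussExpect_le` — the Gaussian instance with LEMMA 21's Hadamard bound (`√‖Γ‖₍₂₎ ≤ h₂`, constant
  weight `h₂` on the integrated block; «on a unit lattice `|∫f(Ψ)dμ_I(Ψ)| ≤ ‖f‖₁`» is `h₂ = 1`).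
* §2 `hNormW_mapSnd_le` — a function of the primed fields alone keeps its norm: `‖G(Ψ′)‖_{(w₁,w₂)} ≤ ‖G‖_{w₂}`;
  `hNormW_mul_mapSnd_le` — `‖F·G(Ψ′)‖_{(w₁,w₂)} ≤ ‖F‖_{(w₁,w₂)}‖G‖_{w₂}` (LEMMA 19 = `hNormW_mul_le`).
* §3 **the scaling** `Ψ_j ↦ Ψ_{j,L^{−1}}`, `Ψ_{L^{−1}}(x) = LΨ(Lx)`, as a diagonal substitution of the generators (the
  relabelling `x ↦ Lx` of sites being a renaming of generators): `subst_diagonal_gen`, `subst_diagonal_grassmannBasis`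
  (`θ_S(dΨ) = (Π_{ξ∈S}d_ξ)θ_S`), **`hNormW_subst_diagonal_le`** — `‖F(dΨ)‖_w ≤ ‖F‖_{|d|·w}`: scaling a field by `L`
  multiplies its weight by `L` — this is «`(LI_k, 1) = I_{k+1}`», «`‖F′_{k+1,L}‖_{I_k,1,I_{k+1}} ≤ ‖F_{k+1}‖_{LI_k,1,LI_{k+1}}`».
* §4 **the Gaussian normalizing factor**: `hNormW_grassmannExp_le` — `‖e^{Q}‖_w ≤ e^{‖Q‖_w}` for nilpotent `Q` (the
  finite exponential series and LEMMA 19); `hNorm_one_quadratic_one_le` — «`‖⟨Ψ̄′,Ψ′⟩_Ω‖₁`» `≤ |Ω|` (the identity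
  quadratic form at weight `1`; `|Ω|` = the number of fermion labels on `Ω`).
* §5 **the step (452)∕(455)**: **`lemma20_step`** — for `μ` with `|μ(θ′_T)| ≤ 1` (unit Gaussian), weights
  `0 ≤ w′ ≤ w` on the kept block, a scaling `d` with `|d|·(w,1) ≤ (w_L,1)`, a nilpotent `Q` on the integrated block with
  `‖Q‖₁ ≤ n`, and `L ≥ 0`: `‖L^{m}·∫F(dΨ)e^{Q}dμ(Ψ′)‖_{w′} ≤ L^{m}e^{n}‖F‖_{(w_L,1)}`; **`lemma20_step_printed`** — the
  printed instance: `d = L` on the kept block and `1` on the integrated block `Ψ̄′,Ψ′` indexed by `X ⊕ₗ X`,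
  `Q = −⟨Ψ̄′,Ψ′⟩`, `m = n = |X|`: `‖F_k‖_{w} ≤ e^{(1+log L)|X|}‖F_{k+1}‖_{(Lw,1)}` (`pow_mul_exp_eq`: `L^{n}e^{n} =
  e^{(1+log L)n}`, the printed `exp(C|δΩ^{(k+1)}_{k+1}|)` with `C = 1 + log L`).
* §6 **(456) and (449)**: `lemma20_iterate` — `a_k ≤ e^{Cn_{k+1}}a_{k+1}` (`k < K`) ⟹ `a_0 ≤ e^{CΣ_{j=1}^{K}n_j}a_K`;
  `lemma20_assembled` — with (457) `|J| ≤ e^{n_0}a_0`, (456) and LEMMA 19's (435) `a_K ≤ e^{S}`: `|J| ≤ e^{n_0 + CΣn_j + S}`.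

**Readings (declared).**  (i) The fields of one RG level form one block of generators; the history-dependent regions
enter only through the label sets and the counts `n = |δΩ^{(k+1)}_{k+1}|` (here `|X|`, the number of fermion labels —
sites × spinor components — on the region; the print absorbs the spinor multiplicity in `C`).  (ii) The scaling
`F′_{k+1,L}` is the diagonal substitution by `L` on the kept fields (the accompanying relabelling of lattice sites
`x ↦ Lx` renames generators and does not change norms); the Berezin scaling `DΨ_{L} = L^{|Ω|}DΨ′` is the scalar
prefactor `L^{m}`.  (iii) «we artificially introduce a Gaussian integral by `DΨ′ = e^{⟨Ψ̄′,Ψ′⟩}dμ_I(Ψ′)`» (the identity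
between the Berezin integral and the unit Gaussian expectation) is not reproduced: the step starts from the
representation `F_k = L^{m}∫F′e^{Q}dμ(Ψ′)` with `μ` any functional obeying the unit monomial bound `|μ(θ′_T)| ≤ 1`
(for `∫·dμ_I` this is D12 LEMMA 21 with `‖Γ‖₍₂₎ = 1`, `hNormW_partialGaussExpect_le`).  (iv) `C = 1 + log L`, and
`exp` of a Grassmann element is the tree's algebraic `grassmannExp` (finite series; nilpotent exponent).

**Honest scope.**  Grassmann-norm bookkeeping of one integration step and its iteration; LEMMAS 18–19 ((427)–(448):
the recursive representation and the bound on `F_K`), (457)'s Gaussian evaluation and the regions themselves are NOT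
constructed — they are the hypotheses `h457`, `h435` and the label types.  No `d = 4` statement; nothing about
Bałaban's papers.
**v1.1 (APPEND-ONLY; §§1–6 byte-identical; one import added) — LEMMA 19's (435) assembled from (421), (445), (448).**
p.59 L22–36: *"Lemma 19. With `Λ_K = ∅`, `Λ_0 ≡ Ω_1` and `δΛ_{j−1} = Λ_{j−1} − Λ_j` `‖F_K‖_{I_K,LI_K} ≤ exp(CΣ_{j=1}^{K}|δΩ_j^{(j)}|
+ Σ_{j=1}^{K}|δΛ^{(j)}_{j−1}|)` (435) Proof. From (421) `F_K = exp(−S_{K,Ω} + B_{K,Π})`. For each of `S_{K,Ω}` and `B_{K,Π}` we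
express the object in the fundamental fields … and then estimate the norm of the kernel."*; p.60 L1–2: *"… and so
`‖S_{k,Ω}(A)‖_{I_K,LI_K} ≤ CΣ_j|δΩ_j^{(j)}|`"* (445); p.60 L85–94: *"`‖B_{K,Π}‖_{h_KI#_K,LI_K} ≤ … ≤
O(1)e_K^{1∕4−8ε}M⁻³Σ_{j=1}^{K}|δΛ^{(j)}_{j−1}|` (448) We throw away the small factor `O(1)e_K^{1∕4−8ε}M⁻³ ≤ 1`. The resulting
bound combined with (445) completes the proof."*  §7 adds, in the Banach algebra `(𝒢, ‖·‖_w)` of the tree's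
`QED3GrassmannMultiweightNormedAlgebra` (the multiscale norm `‖·‖_{I_K,LI_K}` is such a weight `w`): `throw_away_small_factor`
((448)'s last step), **`lemma19_of_445_448`** — `‖exp(−S_K + B_K)‖_w ≤ exp(‖S_K‖_w + ‖B_K‖_w) ≤ exp(CΣ|δΩ| + Σ|δΛ|)`
(`‖e^{Y}‖ ≤ e^{‖Y‖}`, the tree's `QuantumLattice.norm_exp_le`), i.e. (435) from the two kernel estimates — which are NOT
reproduced ((436)–(444), (446)–(447)).  Writer seat p11 (literature-prover-lit-balaban-p11-g26-0).

**v1.2 (APPEND-ONLY; §§1–7 byte-identical; no import added) — LEMMA 19's proof part A, the kernel terms (436)–(441).**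
The printed text, p.59 L37–86: *"Proof. From (421) `F_K = exp(−S_{K,Ω} + B_{K,Π})`. For each of `S_{K,Ω}` and `B_{K,Π}` we
express the object in the fundamental fields `Ψ_{k,Ω}, W_{K,Ω}` and then estimate the norm of the kernel. A. For `S_{K,Ω}` we
have from (169) `S_{K,Ω}(A,Ψ_{K,Ω},ψ_{K,Ω}(A)) = ⟨Ψ̄_{K,Ω},D_{K,Ω}(A)Ψ_{K,Ω}⟩ + …` (436) where `D_{K,Ω}(A) = b^{(K)} −
b^{(K)}Q_{K,Ω}(A)S_{K,Ω}(A)Qᵀ_{K,Ω}(−A)b^{(K)}` (437) First consider the term `⟨Ψ̄_{K,Ω},b^{(K)}Ψ_{K,Ω}⟩ =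
Σ_jΣ_{y∈δΩ^{(j)}_j}L^{−3(K−j)}b^{(K)}_jΨ̄_j(y)Ψ_j(y)` (438) Since `I_K` is `L^{K−j}` in `δΩ^{(j)}_j` and since `b^{(K)}_j = b_jL^{K−j}`
with `b_j` bounded we have `‖⟨Ψ̄_{K,Ω},bΨ_{K,Ω}⟩‖_{I_K} ≤ Σ_{j=1}^{K}Σ_{y∈δΩ^{(j)}_j}L^{−3(K−j)}b^{(K)}_jL^{2(K−j)} = Σ_jb_j|δΩ^{(j)}_j| ≤
CΣ_j|δΩ^{(j)}_j|` (439)"*.  p.59 L86–129: *"The second term in (437) is called `M_{K,Ω}(A)` as in (170) and we have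
`⟨Ψ̄_{K,Ω},M_{K,Ω}(A)Ψ_{K,Ω}⟩ = Σ_{j,j′}Σ_{y∈δΩ^{(j)}_j,y′∈δΩ^{(j′)}_{j′}}Ψ̄_j(y)L^{−3(k−j)}M_{K,Ω}(A;y,y′)L^{−3(k−j′)}Ψ_{j′}(y′)` (440)
Using the estimate (179) on `M_{K,Ω}(A,y,y′)` we have `‖⟨Ψ̄_{K,Ω},M_{K,Ω}(A)Ψ_{K,Ω}⟩‖_{I_K} ≤ Σ_{j,j′}Σ_{y,y′}
Ψ_j(y)L^{−2(k−j)}|M_{K,Ω}(A;y,y′)|L^{−2(k−j′)} ≤ CΣ_{j,j′}Σ_{y,y′}e^{−γd_Ω(y,y′)} ≤ CΣ_jΣ_{y∈δΩ^{(j)}_j} ≤ CΣ_{j=1}^{K}|δΩ^{(j)}_j|`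
(441)"*; p.60 L1–2: *"The other terms in (436) are estimated similarly, and so `‖S_{k,Ω}(A)‖_{I_K,LI_K} ≤ CΣ_j|δΩ^{(j)}_j|`"*.
§8 adds, on the generators `X ⊕ₗ X` (`ψ̄_y`, `ψ_y` for the sites `y : X` of `⋃_jδΩ^{(j)}_j`, each carrying its scale
`s(y) = j ≤ K`) with the multiscale weight `I_K`: `w(ψ̄_y) = w(ψ_y) = L^{K−s(y)}` (`sumWeight v v`):
**`hNormW_quadratic_le`**, `hNormW_quadratic_le_sites` — the kernel bound `‖Σ_{ij}A_{ij}ψ̄_iψ_j‖_w ≤ Σ_{ij}w(ψ̄_i)|A_{ij}|w(ψ_j)`;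
`eq439_scaling`, **`eq439`** — (439) with the printed arithmetic, bound `C·|X|`, `|X| = Σ_j|δΩ^{(j)}_j|`
(`card_sites_eq_sum_scales`); `eq441_scaling`, **`eq441`** — (441) from (179) in the row-summable form `L^{−2(K−j)}|M(y,y′)|
L^{−2(K−j′)} ≤ c·E(y,y′)`, `Σ_{y′}E(y,y′) ≤ c′`, bound `c·c′·|X|`; **`eq445_kernel_terms`** — the two terms together,
`‖⟨Ψ̄,(diag − kernel)Ψ⟩‖_{I_K} ≤ (C + cc′)|X|`.  Not reproduced: the «other terms» of (436) (those through `ψ_{K,Ω}(A) =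
H_{K,Ω}(A)Ψ_{K,Ω}`), (170)∕(179) themselves, part B (442)–(447).  §9 adds the volume
bookkeeping (487) ⟹ (488) p.66 L52–62 (*"For `0 ≤ j ≤ K − 1` we use `|δΩ^{(j)}_j| ≤ … ≤ |Λ^{(j+1),c}_{j+1}|`. For `j = K` … Hence we
have `|J_{K,Π}| ≤ exp(CΣ_{j=1}^{K}|Λ^{(j),c}_j|)`"*): **`eq488_volumes`**, **`eq488_of_lemma20`** (LEMMA 20's exponent re-indexed on
`b_j = |Λ^{(j),c}_j|`, constant `2C + 1`).  Writer seat p11 (literature-prover-lit-balaban-p11-g26-0).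
-/

/-! **v1.3** (p11 gen 27): §10 `lemma19_of_446` — LEMMA 19 (435) with part B discharged to the basic bound (446), the
polymer bookkeeping (447)–(448) supplied by `QED3BoundaryActivitySum` (`eq448_of_446`, `small_factor_le_one`). -/

noncomputable section

open Finset

namespace Literature.MathematicalPhysics.QuantumFieldTheory.Dimock2011to13

namespace QED3LargeFieldFermion

open Literature.MathematicalPhysics.QuantumLattice
open Literature.MathematicalPhysics.QuantumLattice.GrassmannAlgebra
open QED3TorusI

variable {𝕜 : Type*} [RCLike 𝕜]

/-! ## §1 Mixed weights on two blocks of generators, and D12 LEMMA 22 for them -/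

section Mixed

variable {ι₁ ι₂ : Type*} [LinearOrder ι₁] [Fintype ι₁] [LinearOrder ι₂] [Fintype ι₂]

/-- **Mixed weight** `(w₁, w₂)`: weight `w₁` on the kept block `ι₁`, `w₂` on the integrated block `ι₂` — the «mixed
versions» of the norms (528)–(536) (e.g. `‖·‖_{I_k,1,LI_k,1}` of (455): multiscale on the kept fields, `1` on `Ψ′_{k+1}`).
[cite: Dimock2022UVStabilityQED3, App. B p.73 L27–28, (533)–(536) p.74 L40–65] -/
def sumWeight (w₁ : ι₁ → ℝ) (w₂ : ι₂ → ℝ) : ι₁ ⊕ₗ ι₂ → ℝ := fun a => Sum.elim w₁ w₂ (ofLex a)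

omit [LinearOrder ι₁] [Fintype ι₁] [LinearOrder ι₂] [Fintype ι₂] in
/-- On the kept block the mixed weight is `w₁`. [cite: Dimock2022UVStabilityQED3, App. B (533)–(536) p.74 L40–65] -/
@[simp] theorem sumWeight_inl (w₁ : ι₁ → ℝ) (w₂ : ι₂ → ℝ) (a : ι₁) :
    sumWeight w₁ w₂ (toLex (Sum.inl a)) = w₁ a := rfl

omit [LinearOrder ι₁] [Fintype ι₁] [LinearOrder ι₂] [Fintype ι₂] in
/-- On the integrated block the mixed weight is `w₂`. [cite: Dimock2022UVStabilityQED3, App. B (533)–(536) p.74 L40–65] -/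
@[simp] theorem sumWeight_inr (w₁ : ι₁ → ℝ) (w₂ : ι₂ → ℝ) (b : ι₂) :
    sumWeight w₁ w₂ (toLex (Sum.inr b)) = w₂ b := rfl

omit [LinearOrder ι₁] [Fintype ι₁] [LinearOrder ι₂] [Fintype ι₂] in
/-- Nonnegative block weights give a nonnegative mixed weight. [cite: Dimock2022UVStabilityQED3, App. B (533)–(536) p.74 L40–65] -/
theorem sumWeight_nonneg {w₁ : ι₁ → ℝ} {w₂ : ι₂ → ℝ} (h1 : ∀ a, 0 ≤ w₁ a) (h2 : ∀ b, 0 ≤ w₂ b) (ξ : ι₁ ⊕ₗ ι₂) :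
    0 ≤ sumWeight w₁ w₂ ξ := by
  obtain ⟨ξ, rfl⟩ := toLex.surjective ξ
  rcases ξ with a | b
  · exact h1 a
  · exact h2 b

omit [Fintype ι₁] [Fintype ι₂] in
/-- The mixed weight of `θ_{S₁}θ′_{S₂}` is `(Π_{S₁}w₁)(Π_{S₂}w₂)` — the factor `h₁^{n}h₂^{m}` of (533).
[cite: Dimock2022UVStabilityQED3, App. B (533) p.74 L40–47] -/
theorem monoWeight_map_union (w₁ : ι₁ → ℝ) (w₂ : ι₂ → ℝ) (S₁ : Finset ι₁) (S₂ : Finset ι₂) :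
    monoWeight (sumWeight w₁ w₂)
        (S₁.map (inlEmb : ι₁ ↪o ι₁ ⊕ₗ ι₂).toEmbedding ∪ S₂.map (inrEmb : ι₂ ↪o ι₁ ⊕ₗ ι₂).toEmbedding)
      = monoWeight w₁ S₁ * monoWeight w₂ S₂ := by
  classical
  have hd : Disjoint (S₁.map (inlEmb : ι₁ ↪o ι₁ ⊕ₗ ι₂).toEmbedding)
      (S₂.map (inrEmb : ι₂ ↪o ι₁ ⊕ₗ ι₂).toEmbedding) := by
    rw [Finset.disjoint_left]
    intro x hx1 hx2
    obtain ⟨a, _, rfl⟩ := Finset.mem_map.1 hx1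
    obtain ⟨b, _, hb⟩ := Finset.mem_map.1 hx2
    exact absurd hb (by simp [inlEmb, inrEmb])
  rw [monoWeight_union _ hd, monoWeight, monoWeight, monoWeight, Finset.prod_map, Finset.prod_map]
  rfl

/-- The mixed weight of a monomial factors over its two blocks. [cite: Dimock2022UVStabilityQED3, App. B (533) p.74 L40–47] -/
theorem monoWeight_sumWeight (w₁ : ι₁ → ℝ) (w₂ : ι₂ → ℝ) (S : Finset (ι₁ ⊕ₗ ι₂)) :
    monoWeight (sumWeight w₁ w₂) S = monoWeight w₁ (fstPart S) * monoWeight w₂ (sndPart S) := by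
  conv_lhs => rw [← map_fstPart_union_map_sndPart S]
  exact monoWeight_map_union w₁ w₂ _ _

/-- **D12 LEMMA 22 for mixed∕multiscale weights**: if the functional `μ` on the integrated block obeys the monomial bound
`|μ(θ′_T)| ≤ Π_{ξ∈T}w₂(ξ)` and `0 ≤ w₁′ ≤ w₁` pointwise on the kept block, then `‖∫F dμ(Ψ′)‖_{w₁′} ≤ ‖F‖_{(w₁,w₂)}` —
the one-weight statement (317) of [Dimock2002QED3TorusI] (tree: `hNorm_partialExpect_le`) combined per generator, as the
mixed norms are used in (452)∕(455). [cite: Dimock2022UVStabilityQED3, §4.2.1 Lemma 20 proof (452) p.61 L53–67; Dimock2002QED3TorusI, App. B Lemma 22 (317)–(319) p.64 L18–30] -/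
theorem hNormW_partialExpect_le (μ : GrassmannAlgebra 𝕜 ι₂ →ₗ[𝕜] 𝕜) {w₁ w₁' : ι₁ → ℝ} {w₂ : ι₂ → ℝ}
    (h0 : ∀ a, 0 ≤ w₁' a) (hle : ∀ a, w₁' a ≤ w₁ a)
    (hμ : ∀ T : Finset ι₂, ‖μ (grassmannBasis 𝕜 ι₂ T)‖ ≤ monoWeight w₂ T) (F : GrassmannAlgebra 𝕜 (ι₁ ⊕ₗ ι₂)) :
    hNormW w₁' (partialExpect μ F) ≤ hNormW (sumWeight w₁ w₂) F := by
  rw [partialExpect_apply]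
  refine (hNormW_sum_le h0 _ _).trans ?_
  rw [hNormW]
  refine Finset.sum_le_sum fun S _ => ?_
  rw [hNormW_smul, hNormW_smul, hNormW_grassmannBasis, mul_comm, monoWeight_sumWeight]
  refine mul_le_mul_of_nonneg_right ?_ (norm_nonneg _)
  rw [mul_comm]
  exact mul_le_mul (monoWeight_mono h0 hle _) (hμ _) (norm_nonneg _)
    (monoWeight_nonneg (fun a => (h0 a).trans (hle a)) _)

/-- **The Gaussian instance** («In general on a unit lattice `|∫f(Ψ)dμ_I(Ψ)| ≤ ‖f‖₁`»): for `∫·dμ_Γ(Ψ′,Ψ̄′)` = the tree's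
`gaussExpect 𝕜 C` of a charged covariance on the integrated block with `√‖Γ‖₍₂₎ ≤ h₂` (D12 LEMMA 21, Hadamard) and
`0 ≤ w₁′ ≤ w₁`: `‖∫F dμ_Γ(Ψ′)‖_{w₁′} ≤ ‖F‖_{(w₁,h₂)}` (`h₂ = 1` for `dμ_I`).
[cite: Dimock2022UVStabilityQED3, §4.2.1 Lemma 20 proof (452) p.61 L53–58; Dimock2002QED3TorusI, App. B Lemmas 21–22 p.64 L1–30] -/
theorem hNormW_partialGaussExpect_le (q : ι₂ → Bool) (C : Matrix ι₂ ι₂ 𝕜) (hC : ∀ X Y, q X = q Y → C X Y = 0)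
    {w₁ w₁' : ι₁ → ℝ} {h₂ : ℝ} (h0 : ∀ a, 0 ≤ w₁' a) (hle : ∀ a, w₁' a ≤ w₁ a)
    (hΓ : Real.sqrt (twoNorm q (contr 𝕜 C)) ≤ h₂) (F : GrassmannAlgebra 𝕜 (ι₁ ⊕ₗ ι₂)) :
    hNormW w₁' (partialExpect (gaussExpect 𝕜 C) F) ≤ hNormW (sumWeight w₁ fun _ => h₂) F := by
  obtain ⟨hh, hrow⟩ := rowBound_of_sqrt_twoNorm_le q (contr 𝕜 C) hΓ
  refine hNormW_partialExpect_le _ h0 hle (fun T => ?_) F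
  rw [monoWeight_const]
  exact norm_gaussExpect_grassmannBasis_le_pow q C hC hh hrow T

/-! ## §2 A function of the integrated fields alone keeps its own norm -/

/-- `‖G(Ψ′)‖_{(w₁,w₂)} ≤ ‖G‖_{w₂}` for `G` in the primed sub-algebra (monomials go to monomials of the same weight; in
fact an equality). [cite: Dimock2022UVStabilityQED3, §4.2.1 Lemma 20 proof (452) p.61 L59–64 («`exp(‖⟨Ψ̄′_K,Ψ′_K⟩_{Ω_K}‖₁)`»)] -/
theorem hNormW_mapSnd_le {w₁ : ι₁ → ℝ} {w₂ : ι₂ → ℝ} (h1 : ∀ a, 0 ≤ w₁ a) (h2 : ∀ b, 0 ≤ w₂ b)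
    (G : GrassmannAlgebra 𝕜 ι₂) :
    hNormW (sumWeight w₁ w₂) (mapSnd (ι₁ := ι₁) G) ≤ hNormW w₂ G := by
  have hG : G = ∑ T, coeff G T • grassmannBasis 𝕜 ι₂ T := ((grassmannBasis 𝕜 ι₂).sum_repr G).symm
  have hw : ∀ ξ, 0 ≤ sumWeight w₁ w₂ ξ := sumWeight_nonneg h1 h2
  conv_lhs => rw [hG]
  rw [map_sum]
  refine (hNormW_sum_le hw _ _).trans ?_
  rw [hNormW]
  refine Finset.sum_le_sum fun T _ => ?_
  rw [map_smul, hNormW_smul, mul_comm]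
  refine mul_le_mul_of_nonneg_right (le_of_eq ?_) (norm_nonneg _)
  rw [map_extendByZero_grassmannBasis, hNormW_grassmannBasis, monoWeight, Finset.prod_map]
  rfl

/-- `‖F·G(Ψ′)‖_{(w₁,w₂)} ≤ ‖F‖_{(w₁,w₂)}·‖G‖_{w₂}` — LEMMA 19 and §2 (the step
«`‖F′e^{⟨Ψ̄′,Ψ′⟩}‖ ≤ ‖F′‖·exp(‖⟨Ψ̄′,Ψ′⟩‖₁)`»). [cite: Dimock2022UVStabilityQED3, §4.2.1 Lemma 20 proof (452) p.61 L59–64] -/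
theorem hNormW_mul_mapSnd_le {w₁ : ι₁ → ℝ} {w₂ : ι₂ → ℝ} (h1 : ∀ a, 0 ≤ w₁ a) (h2 : ∀ b, 0 ≤ w₂ b)
    (F : GrassmannAlgebra 𝕜 (ι₁ ⊕ₗ ι₂)) (G : GrassmannAlgebra 𝕜 ι₂) :
    hNormW (sumWeight w₁ w₂) (F * mapSnd G) ≤ hNormW (sumWeight w₁ w₂) F * hNormW w₂ G :=
  (hNormW_mul_le (sumWeight_nonneg h1 h2) _ _).trans
    (mul_le_mul_of_nonneg_left (hNormW_mapSnd_le h1 h2 G) (hNormW_nonneg (sumWeight_nonneg h1 h2) _))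

end Mixed

/-! ## §3 Scaling the fields = a diagonal substitution, which multiplies the weights -/

section Scaling

variable {ι : Type*} [LinearOrder ι] [Fintype ι]

/-- A diagonal substitution scales each generator: `Ψ(ξ) ↦ d_ξΨ(ξ)` (the scaling `Ψ_{L^{−1}}(x) = LΨ(Lx)` has `d = L`).
[cite: Dimock2022UVStabilityQED3, §4.2.1 p.57 L32–35 («we scale up replacing `Ψ_j(x)` … by `Ψ_{j,L^{−1}}(x) = LΨ_j(Lx)`»)] -/
theorem subst_diagonal_gen (d : ι → 𝕜) (ξ : ι) :
    subst (Matrix.diagonal d) (gen 𝕜 ξ) = d ξ • gen 𝕜 ξ := by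
  rw [subst_gen, Finset.sum_eq_single ξ]
  · rw [Matrix.diagonal_apply_eq]
  · intro b _ hb; rw [Matrix.diagonal_apply_ne _ (Ne.symm hb), zero_smul]
  · intro h; exact absurd (Finset.mem_univ ξ) h

/-- On monomials: `θ_S(dΨ) = (Π_{ξ∈S}d_ξ)·θ_S`. [cite: Dimock2022UVStabilityQED3, §4.2.1 p.57 L32–35] -/
theorem subst_diagonal_grassmannBasis (d : ι → 𝕜) (S : Finset ι) :
    subst (Matrix.diagonal d) (grassmannBasis 𝕜 ι S) = (∏ ξ ∈ S, d ξ) • grassmannBasis 𝕜 ι S := by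
  induction S using Finset.induction_on_min with
  | empty => simp
  | insert a u hmin ih =>
    have hau : a ∉ u := fun h => lt_irrefl a (hmin a h)
    rw [grassmannBasis_insert_of_forall_lt 𝕜 hmin, map_mul, subst_diagonal_gen, ih, Finset.prod_insert hau,
      smul_mul_smul_comm]

/-- **Scaling multiplies the weights**: `‖F(dΨ)‖_w ≤ ‖F‖_{|d|·w}` — scaling a field by `L` multiplies its weight by `L`,
the bookkeeping «`(LI_k,1) = I_{k+1}`», «`‖F′_{k+1,L}‖_{I_k,1,I_{k+1}} ≤ ‖F_{k+1}‖_{LI_k,1,LI_{k+1}}`» (in fact an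
equality). [cite: Dimock2022UVStabilityQED3, §4.2.1 Lemma 20 proof (452) p.61 L53–67, (455) p.62 L1–30] -/
theorem hNormW_subst_diagonal_le {w : ι → ℝ} (hw : ∀ ξ, 0 ≤ w ξ) (d : ι → 𝕜) (F : GrassmannAlgebra 𝕜 ι) :
    hNormW w (subst (Matrix.diagonal d) F) ≤ hNormW (fun ξ => ‖d ξ‖ * w ξ) F := by
  have hF : F = ∑ S, coeff F S • grassmannBasis 𝕜 ι S := ((grassmannBasis 𝕜 ι).sum_repr F).symm
  conv_lhs => rw [hF]
  rw [map_sum]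
  refine (hNormW_sum_le hw _ _).trans ?_
  rw [hNormW]
  refine Finset.sum_le_sum fun S _ => ?_
  rw [map_smul, hNormW_smul, subst_diagonal_grassmannBasis, hNormW_smul, hNormW_grassmannBasis, mul_comm]
  refine mul_le_mul_of_nonneg_right (le_of_eq ?_) (norm_nonneg _)
  rw [monoWeight, monoWeight, norm_prod, ← Finset.prod_mul_distrib]

end Scaling

/-! ## §4 The Gaussian normalizing factor `e^{∓⟨Ψ̄′,Ψ′⟩_Ω}`: `‖e^{Q}‖_w ≤ e^{‖Q‖_w}` and `‖⟨Ψ̄′,Ψ′⟩_Ω‖₁ ≤ |Ω|` -/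

section ExpFactor

variable {ι : Type*} [LinearOrder ι] [Fintype ι]

/-- `‖e^{Q}‖_w ≤ e^{‖Q‖_w}` for a nilpotent `Q` (the algebraic exponential `Σ_i Q^i∕i!` of the tree; LEMMA 19 on each
power and `Σ_{i<k}x^i∕i! ≤ e^{x}`) — «`‖F′e^{⟨Ψ̄′,Ψ′⟩}‖ ≤ ‖F′‖exp(‖⟨Ψ̄′,Ψ′⟩‖₁)`».
[cite: Dimock2022UVStabilityQED3, §4.2.1 Lemma 20 proof (452) p.61 L59–64, (455) p.62 L1–20] -/
theorem hNormW_grassmannExp_le {w : ι → ℝ} (hw : ∀ ξ, 0 ≤ w ξ) {Q : GrassmannAlgebra 𝕜 ι} (hQ : IsNilpotent Q) :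
    hNormW w (grassmannExp Q) ≤ Real.exp (hNormW w Q) := by
  obtain ⟨k, hk⟩ := hQ
  rw [grassmannExp, IsNilpotent.exp_eq_sum hk]
  refine (hNormW_sum_le hw _ _).trans ?_
  have hterm : ∀ i ∈ Finset.range k,
      hNormW w ((i.factorial : ℚ)⁻¹ • Q ^ i) ≤ (hNormW w Q) ^ i / i.factorial := by
    intro i _
    rw [inv_natCast_smul_eq ℚ 𝕜, hNormW_smul, norm_inv, RCLike.norm_natCast, div_eq_inv_mul]
    exact mul_le_mul_of_nonneg_left (hNormW_pow_le hw Q i) (by positivity)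
  refine (Finset.sum_le_sum hterm).trans ?_
  exact Real.sum_le_exp_of_nonneg (hNormW_nonneg hw Q) k

variable {X : Type*} [LinearOrder X] [Fintype X]

/-- «`‖⟨Ψ̄′_K,Ψ′_K⟩_{Ω_K}‖₁`» `≤ |Ω_K|`: the identity quadratic form `Σ_{x}Ψ̄′(x)Ψ′(x)` over the labels `X` of the region
has weight-`1` norm at most `|X|` (row sums of the identity kernel are `1`; `QED3SmallFieldFermion.hNorm_quadratic_le_of_rowsum`).
[cite: Dimock2022UVStabilityQED3, §4.2.1 Lemma 20 proof (452) p.61 L59–67 («`exp(|Ω_K^{(K)}|)`»)] -/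
theorem hNorm_one_quadratic_one_le :
    hNorm 1 (quadratic 𝕜 (1 : Matrix X X 𝕜) : GrassmannAlgebra 𝕜 (X ⊕ₗ X)) ≤ Fintype.card X := by
  have h := QED3SmallFieldFermion.hNorm_quadratic_le_of_rowsum (h := 1) (c := 1) zero_le_one
    (1 : Matrix X X 𝕜) (fun x => ?_)
  · simpa using h
  · rw [Finset.sum_eq_single x]
    · simp
    · intro b _ hb; rw [Matrix.one_apply_ne (Ne.symm hb), norm_zero]
    · intro hx; exact absurd (Finset.mem_univ x) hx

omit [LinearOrder X] in
/-- The identity quadratic form is nilpotent (no constant term), so its exponential is the finite series.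
[cite: Dimock2022UVStabilityQED3, §4.2.1 Lemma 20 proof (451) p.61 L30–34 («`e^{⟨Ψ̄′_K,Ψ′_K⟩_{Ω_K}}dμ_I(Ψ′_K)`»)] -/
theorem isNilpotent_neg_quadratic_one [LinearOrder X] :
    IsNilpotent (-(quadratic 𝕜 (1 : Matrix X X 𝕜)) : GrassmannAlgebra 𝕜 (X ⊕ₗ X)) :=
  (isNilpotent_quadratic 𝕜 _).neg

end ExpFactor

/-! ## §5 LEMMA 20, the integration step (452)∕(455) -/

section Step

variable {ι₁ ι₂ : Type*} [LinearOrder ι₁] [Fintype ι₁] [LinearOrder ι₂] [Fintype ι₂]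

/-- **The step (455), abstract blocks**: `F_k = L^{m}∫F_{k+1}(dΨ)·e^{Q}dμ(Ψ′)` with `μ` obeying the unit monomial bound
`|μ(θ′_T)| ≤ 1` («`|∫f(Ψ)dμ_I(Ψ)| ≤ ‖f‖₁`»), weights `0 ≤ w′ ≤ w` on the kept block, a scaling `d` with
`|d_ξ|·(w,1)_ξ ≤ (w_L,1)_ξ` («`(LI_k,1) = I_{k+1}`»), `Q` nilpotent on the integrated block with `‖Q‖₁ ≤ n`, `L ≥ 0`:
`‖F_k‖_{w′} ≤ L^{m}·e^{n}·‖F_{k+1}‖_{(w_L,1)}` — the chain «`≤ L^{|δΩ|}‖F′e^{Q}‖_{I_k,1,…} ≤ L^{|δΩ|}‖F′‖_{I_k,1,I_{k+1}}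
exp(‖Q‖₁) ≤ L^{|δΩ|}‖F_{k+1}‖_{LI_k,1,LI_{k+1}}exp(|δΩ|)`».
[cite: Dimock2022UVStabilityQED3, §4.2.1 Lemma 20 proof (452) p.61 L53–67, (455) p.62 L1–30] -/
theorem lemma20_step (μ : GrassmannAlgebra 𝕜 ι₂ →ₗ[𝕜] 𝕜) (hμ : ∀ T : Finset ι₂, ‖μ (grassmannBasis 𝕜 ι₂ T)‖ ≤ 1)
    {w w' wL : ι₁ → ℝ} (h0 : ∀ a, 0 ≤ w' a) (hle : ∀ a, w' a ≤ w a)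
    (d : ι₁ ⊕ₗ ι₂ → 𝕜) (hd : ∀ ξ, ‖d ξ‖ * sumWeight w (fun _ => (1:ℝ)) ξ ≤ sumWeight wL (fun _ => (1:ℝ)) ξ)
    (F : GrassmannAlgebra 𝕜 (ι₁ ⊕ₗ ι₂)) {Q : GrassmannAlgebra 𝕜 ι₂} (hQn : IsNilpotent Q) {n : ℝ}
    (hQ : hNormW (fun _ => (1:ℝ)) Q ≤ n) {L : ℝ} (hL : 0 ≤ L) (m : ℕ) :
    hNormW w' ((L ^ m : 𝕜) • partialExpect μ (subst (Matrix.diagonal d) F * mapSnd (grassmannExp Q)))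
      ≤ L ^ m * Real.exp n * hNormW (sumWeight wL fun _ => (1:ℝ)) F := by
  have hw0 : ∀ a, 0 ≤ w a := fun a => (h0 a).trans (hle a)
  have h1 : ∀ ξ : ι₁ ⊕ₗ ι₂, 0 ≤ sumWeight w (fun _ : ι₂ => (1:ℝ)) ξ :=
    sumWeight_nonneg hw0 (fun _ => zero_le_one)
  rw [hNormW_smul, norm_pow, RCLike.norm_ofReal, abs_of_nonneg hL, mul_assoc]
  refine mul_le_mul_of_nonneg_left ?_ (pow_nonneg hL _)
  -- the partial integration, at weight `1` on the integrated block
  have hμ' : ∀ T : Finset ι₂, ‖μ (grassmannBasis 𝕜 ι₂ T)‖ ≤ monoWeight (fun _ => (1:ℝ)) T := by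
    intro T; rw [monoWeight_const, one_pow]; exact hμ T
  refine (hNormW_partialExpect_le μ h0 hle hμ' _).trans ?_
  -- the exponential factor comes out with `e^{‖Q‖₁}`
  refine (hNormW_mul_mapSnd_le hw0 (fun _ => zero_le_one) _ _).trans ?_
  have hexp : hNormW (fun _ => (1:ℝ)) (grassmannExp Q) ≤ Real.exp n :=
    (hNormW_grassmannExp_le (fun _ => zero_le_one) hQn).trans (Real.exp_le_exp.mpr hQ)
  -- the scaling multiplies the weights of the kept fields
  have hsc : hNormW (sumWeight w fun _ => (1:ℝ)) (subst (Matrix.diagonal d) F)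
      ≤ hNormW (sumWeight wL fun _ => (1:ℝ)) F :=
    (hNormW_subst_diagonal_le h1 d F).trans (hNormW_mono (fun ξ => mul_nonneg (norm_nonneg _) (h1 ξ)) hd F)
  rw [mul_comm]
  exact mul_le_mul hexp hsc (hNormW_nonneg h1 _) (Real.exp_pos _).le

/-- The printed constant: `L^{n}e^{n} = e^{(1 + log L)n}` (`L > 0`), i.e. «`exp(C|δΩ^{(k+1)}_{k+1}|)`» with `C = 1 + log L`.
[cite: Dimock2022UVStabilityQED3, §4.2.1 Lemma 20 proof (452) p.61 L65–67, (455) p.62 L21–30] -/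
theorem pow_mul_exp_eq {L : ℝ} (hL : 0 < L) (m : ℕ) :
    L ^ m * Real.exp m = Real.exp ((1 + Real.log L) * m) := by
  rw [add_mul, one_mul, Real.exp_add, Real.exp_mul, Real.exp_log hL, Real.rpow_natCast, mul_comm]

variable {X : Type*} [LinearOrder X] [Fintype X]

/-- The printed scaling: `d = L` on the kept fields, `1` on the integrated block `Ψ̄′,Ψ′` (labels `X ⊕ₗ X`).
[cite: Dimock2022UVStabilityQED3, §4.2.1 Lemma 20 proof (451) p.61 L35–52 («the prime means the scaling in `F′_{K,L}` is in all fields except `Ψ′_{K,Ω_K}`»)] -/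
def printedScaling (L : ℝ) : ι₁ ⊕ₗ (X ⊕ₗ X) → 𝕜 := fun ξ => Sum.elim (fun _ => (L : 𝕜)) (fun _ => 1) (ofLex ξ)

omit [LinearOrder ι₁] [Fintype ι₁] [LinearOrder X] [Fintype X] in
/-- The printed scaling multiplies the kept weights by `L` and leaves the weight `1` of `Ψ′` alone: «`(LI_k,1) = I_{k+1}`».
[cite: Dimock2022UVStabilityQED3, §4.2.1 Lemma 20 proof (452) p.61 L58, (455) p.62 L1] -/
theorem norm_printedScaling_mul_sumWeight {L : ℝ} (hL : 0 ≤ L) (w : ι₁ → ℝ) (ξ : ι₁ ⊕ₗ (X ⊕ₗ X)) :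
    ‖printedScaling (𝕜 := 𝕜) (X := X) L ξ‖ * sumWeight w (fun _ => (1:ℝ)) ξ
      = sumWeight (fun a => L * w a) (fun _ => (1:ℝ)) ξ := by
  obtain ⟨ξ, rfl⟩ := toLex.surjective ξ
  rcases ξ with a | b
  · simp [printedScaling, abs_of_nonneg hL]
  · simp [printedScaling]

/-- **The step (455) as printed**: the integrated block is `Ψ̄′_{k+1},Ψ′_{k+1}` on the region (labels `X ⊕ₗ X`, `|X|`
labels), `Q = −⟨Ψ̄′,Ψ′⟩`, the scaling is `L` on the kept fields, the prefactor is `L^{|X|}`, and `μ` obeys the unit bound: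
`‖F_k‖_{w′} ≤ e^{(1+log L)|X|}·‖F_{k+1}‖_{(Lw,1)}` for `0 ≤ w′ ≤ w`, `L > 0` — «`‖F_k‖_{I_k,LI_k} ≤
‖F_{k+1}‖_{I_{k+1},LI_{k+1}}exp(C|δΩ^{(k+1)}_{k+1}|)`».
[cite: Dimock2022UVStabilityQED3, §4.2.1 Lemma 20 proof (452) p.61 L53–67, (455) p.62 L1–30] -/
theorem lemma20_step_printed (μ : GrassmannAlgebra 𝕜 (X ⊕ₗ X) →ₗ[𝕜] 𝕜)
    (hμ : ∀ T : Finset (X ⊕ₗ X), ‖μ (grassmannBasis 𝕜 (X ⊕ₗ X) T)‖ ≤ 1)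
    {w w' : ι₁ → ℝ} (h0 : ∀ a, 0 ≤ w' a) (hle : ∀ a, w' a ≤ w a) {L : ℝ} (hL : 0 < L)
    (F : GrassmannAlgebra 𝕜 (ι₁ ⊕ₗ (X ⊕ₗ X))) :
    hNormW w' ((L ^ Fintype.card X : 𝕜) •
        partialExpect μ (subst (Matrix.diagonal (printedScaling L)) F * mapSnd (grassmannExp (-(quadratic 𝕜 1)))))
      ≤ Real.exp ((1 + Real.log L) * Fintype.card X) * hNormW (sumWeight (fun a => L * w a) fun _ => (1:ℝ)) F := by
  have hQ : hNormW (fun _ => (1:ℝ)) (-(quadratic 𝕜 (1 : Matrix X X 𝕜)) : GrassmannAlgebra 𝕜 (X ⊕ₗ X))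
      ≤ Fintype.card X := by
    rw [hNormW_const, HGrassmann.hNorm_neg]
    exact hNorm_one_quadratic_one_le
  have key := lemma20_step μ hμ h0 hle (printedScaling L)
    (fun ξ => (norm_printedScaling_mul_sumWeight (𝕜 := 𝕜) hL.le w ξ).le) F isNilpotent_neg_quadratic_one hQ hL.le
    (Fintype.card X)
  rw [pow_mul_exp_eq hL] at key
  exact key

end Step

/-! ## §6 The iteration (456) and LEMMA 20 (449) assembled -/

section Iterate

/-- **(456), the iteration**: `a_k ≤ e^{Cn_{k+1}}a_{k+1}` for `k < K` (`a_k = ‖F_k‖_{I_k,LI_k}`, `n_j = |δΩ^{(j)}_j|`, the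
step (455)) ⟹ `a_0 ≤ exp(CΣ_{j=1}^{K}n_j)·a_K`. [cite: Dimock2022UVStabilityQED3, §4.2.1 Lemma 20 proof (456) p.62 L31–36] -/
theorem lemma20_iterate (a : ℕ → ℝ) (n : ℕ → ℝ) (C : ℝ) (K : ℕ)
    (hstep : ∀ k < K, a k ≤ Real.exp (C * n (k + 1)) * a (k + 1)) :
    a 0 ≤ Real.exp (C * ∑ j ∈ Finset.range K, n (j + 1)) * a K := by
  induction K with
  | zero => simp
  | succ K ih =>
    have h1 := ih fun k hk => hstep k (Nat.lt_succ_of_lt hk)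
    have h2 := hstep K (Nat.lt_succ_self K)
    rw [Finset.sum_range_succ, mul_add, Real.exp_add]
    calc a 0 ≤ Real.exp (C * ∑ j ∈ Finset.range K, n (j + 1)) * a K := h1
      _ ≤ Real.exp (C * ∑ j ∈ Finset.range K, n (j + 1)) * (Real.exp (C * n (K + 1)) * a (K + 1)) :=
          mul_le_mul_of_nonneg_left h2 (Real.exp_pos _).le
      _ = Real.exp (C * ∑ j ∈ Finset.range K, n (j + 1)) * Real.exp (C * n (K + 1)) * a (K + 1) := by ring

/-- **LEMMA 20 (449) assembled**: (457) «an additional factor `e^{|δΩ_0^{(0)}|}`» `|J| ≤ e^{n_0}a_0`, the iteration (456)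
`a_0 ≤ e^{S₁}a_K` and LEMMA 19's (435) `a_K ≤ e^{S₂}` (`S₁ = CΣ_{j≥1}|δΩ_j^{(j)}|`, `S₂ = C(Σ_j|δΩ_j^{(j)}| + Σ_j|δΛ^{(j)}_{j−1}|)`)
give `|J_{K,Π}| ≤ e^{n_0 + S₁ + S₂}`. [cite: Dimock2022UVStabilityQED3, §4.2.1 Lemma 20 (449) p.60 L96–107; proof (456)–(457) p.62 L31–38; Lemma 19 (435) p.59 L22–35] -/
theorem lemma20_assembled {J a0 aK n0 S₁ S₂ : ℝ} (h457 : |J| ≤ Real.exp n0 * a0) (h456 : a0 ≤ Real.exp S₁ * aK)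
    (h435 : aK ≤ Real.exp S₂) : |J| ≤ Real.exp (n0 + S₁ + S₂) := by
  rw [Real.exp_add, Real.exp_add]
  calc |J| ≤ Real.exp n0 * a0 := h457
    _ ≤ Real.exp n0 * (Real.exp S₁ * aK) := mul_le_mul_of_nonneg_left h456 (Real.exp_pos _).le
    _ ≤ Real.exp n0 * (Real.exp S₁ * Real.exp S₂) :=
        mul_le_mul_of_nonneg_left (mul_le_mul_of_nonneg_left h435 (Real.exp_pos _).le) (Real.exp_pos _).le
    _ = Real.exp n0 * Real.exp S₁ * Real.exp S₂ := by ring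

end Iterate

/-! ## §7 (v1.1) LEMMA 19 (435) assembled from (421) `F_K = exp(−S_K + B_K)`, (445) and (448) -/

section Lemma19

open HGrassmannW

variable {ι : Type*} [LinearOrder ι] [Fintype ι] {w : ι → ℝ} [Fact (∀ ξ : ι, 0 < w ξ)]

/-- **(448), last step** «We throw away the small factor `O(1)e_K^{1∕4−8ε}M⁻³ ≤ 1`»: `b ≤ t·s` with `t ≤ 1`, `0 ≤ s` gives
`b ≤ s`. [cite: Dimock2022UVStabilityQED3, §4.2.1 Lemma 19 proof (448) p.60 L85–94] -/
theorem throw_away_small_factor {b t s : ℝ} (hb : b ≤ t * s) (ht : t ≤ 1) (hs : 0 ≤ s) : b ≤ s :=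
  hb.trans ((mul_le_mul_of_nonneg_right ht hs).trans (by rw [one_mul]))

/-- **LEMMA 19 (435) from (421), (445), (448)**: in the Banach algebra `(𝒢, ‖·‖_w)` (multiscale weight `w = (I_K, LI_K)`),
`F_K = exp(−S_K + B_K)` with `‖S_K‖_w ≤ s₁` ((445): `s₁ = CΣ_j|δΩ_j^{(j)}|`) and `‖B_K‖_w ≤ s₂` ((448) after the small
factor is thrown away: `s₂ = Σ_j|δΛ^{(j)}_{j−1}|`) satisfies `‖F_K‖_w ≤ exp(s₁ + s₂)` — since `‖e^{Y}‖ ≤ e^{‖Y‖}` and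
`‖−S + B‖ ≤ ‖S‖ + ‖B‖`. [cite: Dimock2022UVStabilityQED3, §4.2.1 Lemma 19 (435) p.59 L22–36; proof (421) p.57 L30, (445) p.60 L1–2, (448) p.60 L85–94] -/
theorem lemma19_of_445_448 (S B : HGrassmannW 𝕜 ι w) {s₁ s₂ : ℝ} (h445 : ‖S‖ ≤ s₁) (h448 : ‖B‖ ≤ s₂) :
    ‖NormedSpace.exp (-S + B)‖ ≤ Real.exp (s₁ + s₂) := by
  refine (QuantumLattice.norm_exp_le 𝕜 (-S + B)).trans (Real.exp_le_exp.mpr ?_)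
  calc ‖-S + B‖ ≤ ‖-S‖ + ‖B‖ := norm_add_le _ _
    _ = ‖S‖ + ‖B‖ := by rw [norm_neg]
    _ ≤ s₁ + s₂ := add_le_add h445 h448

/-- (435) in the printed letters: `‖F_K‖ ≤ exp(CΣ_{j=1}^{K}|δΩ_j^{(j)}| + Σ_{j=1}^{K}|δΛ^{(j)}_{j−1}|)` from (445)
`‖S_K‖ ≤ CΣ_j n_j` and (448) `‖B_K‖ ≤ t·Σ_j m_j`, `t = O(1)e_K^{1∕4−8ε}M⁻³ ≤ 1`.
[cite: Dimock2022UVStabilityQED3, §4.2.1 Lemma 19 (435) p.59 L22–36; proof (445) p.60 L1–2, (448) p.60 L85–94] -/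
theorem lemma19 (S B : HGrassmannW 𝕜 ι w) (s : Finset ℕ) (n m : ℕ → ℝ) {C t : ℝ}
    (hm : ∀ j ∈ s, 0 ≤ m j) (h445 : ‖S‖ ≤ C * ∑ j ∈ s, n j) (h448 : ‖B‖ ≤ t * ∑ j ∈ s, m j) (ht : t ≤ 1) :
    ‖NormedSpace.exp (-S + B)‖ ≤ Real.exp (C * ∑ j ∈ s, n j + ∑ j ∈ s, m j) :=
  lemma19_of_445_448 S B h445 (throw_away_small_factor h448 ht (Finset.sum_nonneg hm))

end Lemma19

/-! ## §8 (v1.2) LEMMA 19 proof part A, (436)–(441): the kernel terms of `⟨Ψ̄_{K,Ω}, D_{K,Ω}(A)Ψ_{K,Ω}⟩` in the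
multiscale norm `‖·‖_{I_K}` -/

section KernelTerms

variable {X : Type*} [LinearOrder X] [Fintype X]

/-- **The kernel bound in the multiscale norm** — *"we express the object in the fundamental fields … and then
estimate the norm of the kernel"*: for any non-negative weight `w` on the generators `ψ̄_i, ψ_j`,
`‖Σ_{ij}A_{ij}ψ̄_iψ_j‖_w ≤ Σ_{ij} w(ψ̄_i)·|A_{ij}|·w(ψ_j)` (the multiweight form of the tree's single-weight
`QED3SmallFieldFermion.hNorm_quadratic_le`; from `hNormW_sum_le`, `hNormW_smul`, `hNormW_mul_le`, `hNormW_gen`).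
[cite: Dimock2022UVStabilityQED3, §4.2.1 Lemma 19 proof p.59 L37–39, (438)–(441) p.59 L51–129; App. B (536) p.74 L55–65] -/
theorem hNormW_quadratic_le {w : X ⊕ₗ X → ℝ} (hw : ∀ ξ, 0 ≤ w ξ) (A : Matrix X X 𝕜) :
    hNormW w (quadratic 𝕜 A) ≤ ∑ i, ∑ j, w (toLex (Sum.inl i)) * ‖A i j‖ * w (toLex (Sum.inr j)) := by
  unfold quadratic
  refine (hNormW_sum_le hw _ _).trans (Finset.sum_le_sum fun i _ => ?_)
  refine (hNormW_sum_le hw _ _).trans (Finset.sum_le_sum fun j _ => ?_)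
  rw [hNormW_smul]
  have hmul := hNormW_mul_le hw (psiBar 𝕜 i : GrassmannAlgebra 𝕜 (X ⊕ₗ X)) (psi 𝕜 j)
  rw [show hNormW w (psiBar 𝕜 i : GrassmannAlgebra 𝕜 (X ⊕ₗ X)) = w (toLex (Sum.inl i)) from hNormW_gen w _,
    show hNormW w (psi 𝕜 j : GrassmannAlgebra 𝕜 (X ⊕ₗ X)) = w (toLex (Sum.inr j)) from hNormW_gen w _] at hmul
  calc ‖A i j‖ * hNormW w (psiBar 𝕜 i * psi 𝕜 j)
      ≤ ‖A i j‖ * (w (toLex (Sum.inl i)) * w (toLex (Sum.inr j))) :=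
        mul_le_mul_of_nonneg_left hmul (norm_nonneg _)
    _ = w (toLex (Sum.inl i)) * ‖A i j‖ * w (toLex (Sum.inr j)) := by ring

/-- The same with ONE weight per site carried by both species (`w(ψ̄_y) = w(ψ_y) = v(y)`, the print's `I_K = L^{K−j}`
on `δΩ_j` for `Ψ̄_j` and `Ψ_j` alike): `‖Σ_{yy′}A_{yy′}ψ̄_yψ_{y′}‖_{(v,v)} ≤ Σ_{yy′} v(y)|A_{yy′}|v(y′)`.
[cite: Dimock2022UVStabilityQED3, §4.2.1 Lemma 19 proof (439) p.59 L63–86, (441) p.59 L98–129] -/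
theorem hNormW_quadratic_le_sites {v : X → ℝ} (hv : ∀ y, 0 ≤ v y) (A : Matrix X X 𝕜) :
    hNormW (sumWeight v v) (quadratic 𝕜 A) ≤ ∑ y, ∑ y', v y * ‖A y y'‖ * v y' := by
  have h := hNormW_quadratic_le (w := sumWeight v v) (fun ξ => ?_) A
  · simpa only [sumWeight_inl, sumWeight_inr] using h
  · unfold sumWeight; cases (ofLex ξ) <;> exact hv _

/-- **(439), the scaling arithmetic**: *"Since `I_K` is `L^{K−j}` in `δΩ^{(j)}_j` and since `b^{(K)}_j = b_jL^{K−j}` with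
`b_j` bounded"* — weight × coefficient × weight `L^{K−j}·(L^{−3(K−j)}b_jL^{K−j})·L^{K−j} = b_j`.
[cite: Dimock2022UVStabilityQED3, §4.2.1 Lemma 19 proof (438)–(439) p.59 L51–86] -/
theorem eq439_scaling {L : ℝ} (hL : L ≠ 0) (n : ℕ) (b : ℝ) :
    L ^ n * ((L ^ (3 * n))⁻¹ * b * L ^ n) * L ^ n = b := by
  have h3 : L ^ (3 * n) = L ^ n * L ^ n * L ^ n := by rw [pow_mul']; ring
  have hn : L ^ n ≠ 0 := pow_ne_zero _ hL
  rw [h3]; field_simp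

/-- **(439)**: the diagonal term `⟨Ψ̄_{K,Ω}, b^{(K)}Ψ_{K,Ω}⟩ = Σ_jΣ_{y∈δΩ^{(j)}_j}L^{−3(K−j)}b^{(K)}_jΨ̄_j(y)Ψ_j(y)` (438)
has multiscale norm `‖·‖_{I_K} ≤ Σ_jΣ_{y∈δΩ^{(j)}_j}L^{−3(K−j)}b^{(K)}_jL^{2(K−j)} = Σ_jb_j|δΩ^{(j)}_j| ≤ CΣ_j|δΩ^{(j)}_j|` — here
the sites `y : X` carry their scale `s(y) = j`, `b^{(K)}_j = b_jL^{K−j}`, `|b_j| ≤ C`, and `Σ_j|δΩ^{(j)}_j| = |X|`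
(`card_sites_eq_sum_scales`). [cite: Dimock2022UVStabilityQED3, §4.2.1 Lemma 19 proof (438)–(439) p.59 L51–86] -/
theorem eq439 {L : ℝ} (hL : 0 < L) (K : ℕ) (s : X → ℕ) (b : ℕ → 𝕜) {C : ℝ} (hb : ∀ j, ‖b j‖ ≤ C) :
    hNormW (sumWeight (fun y => L ^ (K - s y)) (fun y => L ^ (K - s y)))
        (quadratic 𝕜 (Matrix.diagonal fun y => ((L : 𝕜) ^ (3 * (K - s y)))⁻¹ * b (s y) * (L : 𝕜) ^ (K - s y)))
      ≤ C * Fintype.card X := by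
  refine (hNormW_quadratic_le_sites (fun y => by positivity) _).trans ?_
  have hdiag : ∀ y, ∑ y', L ^ (K - s y) *
      ‖Matrix.diagonal (fun y => ((L : 𝕜) ^ (3 * (K - s y)))⁻¹ * b (s y) * (L : 𝕜) ^ (K - s y)) y y'‖
        * L ^ (K - s y') = ‖b (s y)‖ := by
    intro y
    rw [Finset.sum_eq_single y]
    · rw [Matrix.diagonal_apply_eq, norm_mul, norm_mul, norm_inv, norm_pow, norm_pow, RCLike.norm_ofReal,
        abs_of_pos hL]
      exact eq439_scaling hL.ne' _ _
    · intro y' _ hy'; rw [Matrix.diagonal_apply_ne _ (Ne.symm hy'), norm_zero, mul_zero, zero_mul]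
    · intro h; exact absurd (Finset.mem_univ y) h
  rw [Finset.sum_congr rfl fun y _ => hdiag y]
  calc ∑ y, ‖b (s y)‖ ≤ ∑ _y : X, C := Finset.sum_le_sum fun y _ => hb (s y)
    _ = C * Fintype.card X := by rw [Finset.sum_const, nsmul_eq_mul, mul_comm]; rfl

/-- **(441), the scaling arithmetic**: `L^{K−j}·(L^{−3(K−j)}|M(y,y′)|L^{−3(K−j′)})·L^{K−j′} = L^{−2(K−j)}|M(y,y′)|L^{−2(K−j′)}`
(*"`Σ … Ψ_j(y)L^{−2(k−j)}|M_{K,Ω}(A;y,y′)|L^{−2(k−j′)}`"*).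
[cite: Dimock2022UVStabilityQED3, §4.2.1 Lemma 19 proof (440)–(441) p.59 L86–129] -/
theorem eq441_scaling {L : ℝ} (hL : L ≠ 0) (n n' : ℕ) (m : ℝ) :
    L ^ n * ((L ^ (3 * n))⁻¹ * m * (L ^ (3 * n'))⁻¹) * L ^ n' = (L ^ (2 * n))⁻¹ * m * (L ^ (2 * n'))⁻¹ := by
  have h3 : L ^ (3 * n) = L ^ (2 * n) * L ^ n := by rw [← pow_add]; congr 1; ring
  have h3' : L ^ (3 * n') = L ^ (2 * n') * L ^ n' := by rw [← pow_add]; congr 1; ring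
  have hn : L ^ n ≠ 0 := pow_ne_zero _ hL
  have hn' : L ^ n' ≠ 0 := pow_ne_zero _ hL
  have h2n : L ^ (2 * n) ≠ 0 := pow_ne_zero _ hL
  have h2n' : L ^ (2 * n') ≠ 0 := pow_ne_zero _ hL
  rw [h3, h3']; field_simp

/-- **(441)**: the second term `⟨Ψ̄_{K,Ω}, M_{K,Ω}(A)Ψ_{K,Ω}⟩ = Σ_{jj′}Σ_{y,y′}Ψ̄_j(y)L^{−3(k−j)}M_{K,Ω}(A;y,y′)L^{−3(k−j′)}Ψ_{j′}(y′)`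
(440) has `‖·‖_{I_K} ≤ Σ L^{−2(k−j)}|M_{K,Ω}(A;y,y′)|L^{−2(k−j′)} ≤ CΣ_{y,y′}e^{−γd_Ω(y,y′)} ≤ CΣ_jΣ_{y∈δΩ^{(j)}_j} ≤ CΣ_j|δΩ^{(j)}_j|`
— *"Using the estimate (179) on `M_{K,Ω}(A,y,y′)`"*, taken as the hypothesis `h179` (`L^{−2(K−j)}|M(y,y′)|L^{−2(K−j′)} ≤
c·E(y,y′)`) with summable rows `Σ_{y′}E(y,y′) ≤ c′` (the decay `e^{−γd_Ω}`); the bound is `c·c′·|X|`, `|X| = Σ_j|δΩ^{(j)}_j|`.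
[cite: Dimock2022UVStabilityQED3, §4.2.1 Lemma 19 proof (440)–(441) p.59 L86–129] -/
theorem eq441 {L : ℝ} (hL : 0 < L) (K : ℕ) (s : X → ℕ) (M : Matrix X X 𝕜) (E : X → X → ℝ) {c c' : ℝ}
    (hc : 0 ≤ c)
    (h179 : ∀ y y', (L ^ (2 * (K - s y)))⁻¹ * ‖M y y'‖ * (L ^ (2 * (K - s y')))⁻¹ ≤ c * E y y')
    (hrow : ∀ y, ∑ y', E y y' ≤ c') :
    hNormW (sumWeight (fun y => L ^ (K - s y)) (fun y => L ^ (K - s y)))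
        (quadratic 𝕜 (Matrix.of fun y y' =>
          ((L : 𝕜) ^ (3 * (K - s y)))⁻¹ * M y y' * ((L : 𝕜) ^ (3 * (K - s y')))⁻¹))
      ≤ c * c' * Fintype.card X := by
  refine (hNormW_quadratic_le_sites (fun y => by positivity) _).trans ?_
  have hterm : ∀ y y', L ^ (K - s y) *
      ‖(Matrix.of fun y y' => ((L : 𝕜) ^ (3 * (K - s y)))⁻¹ * M y y' * ((L : 𝕜) ^ (3 * (K - s y')))⁻¹) y y'‖
        * L ^ (K - s y') = (L ^ (2 * (K - s y)))⁻¹ * ‖M y y'‖ * (L ^ (2 * (K - s y')))⁻¹ := by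
    intro y y'
    rw [Matrix.of_apply, norm_mul, norm_mul, norm_inv, norm_inv, norm_pow, norm_pow, RCLike.norm_ofReal,
      abs_of_pos hL]
    exact eq441_scaling hL.ne' _ _ _
  simp_rw [hterm]
  calc ∑ y, ∑ y', (L ^ (2 * (K - s y)))⁻¹ * ‖M y y'‖ * (L ^ (2 * (K - s y')))⁻¹
      ≤ ∑ y, ∑ y', c * E y y' := Finset.sum_le_sum fun y _ => Finset.sum_le_sum fun y' _ => h179 y y'
    _ = ∑ y, c * ∑ y', E y y' := by simp_rw [Finset.mul_sum]
    _ ≤ ∑ _y : X, c * c' := Finset.sum_le_sum fun y _ => mul_le_mul_of_nonneg_left (hrow y) hc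
    _ = c * c' * Fintype.card X := by rw [Finset.sum_const, nsmul_eq_mul, mul_comm]; rfl

omit [LinearOrder X] in
/-- `|X| = Σ_{j=0}^{K}|δΩ^{(j)}_j|`: the sites counted by scale (the print's `Σ_j|δΩ^{(j)}_j|`).
[cite: Dimock2022UVStabilityQED3, §4.2.1 Lemma 19 proof (439), (441) p.59 L63–129] -/
theorem card_sites_eq_sum_scales [DecidableEq X] (K : ℕ) (s : X → ℕ) (hs : ∀ y, s y ≤ K) :
    Fintype.card X = ∑ j ∈ Finset.range (K + 1), (Finset.univ.filter fun y => s y = j).card := by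
  rw [← Finset.card_univ, Finset.card_eq_sum_card_fiberwise (f := s) (t := Finset.range (K + 1))]
  intro y _
  exact Finset.mem_range.mpr (Nat.lt_succ_of_le (hs y))

/-- **Towards (445)**: with `D_{K,Ω}(A) = b^{(K)} − b^{(K)}Q S Qᵀb^{(K)}` (437) = diagonal term − kernel term, the two
displayed estimates give `‖⟨Ψ̄_{K,Ω},D_{K,Ω}(A)Ψ_{K,Ω}⟩‖_{I_K} ≤ (C + c·c′)·Σ_j|δΩ^{(j)}_j|` — the (439) + (441) part of *"The
other terms in (436) are estimated similarly, and so `‖S_{k,Ω}(A)‖_{I_K,LI_K} ≤ CΣ_j|δΩ^{(j)}_j|`"* (the «other terms» of (436),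
those through `ψ_{K,Ω}(A)`, are not reproduced). [cite: Dimock2022UVStabilityQED3, §4.2.1 Lemma 19 proof (436)–(441) p.59
L38–129, (445) p.60 L1–2] -/
theorem eq445_kernel_terms {L : ℝ} (hL : 0 < L) (K : ℕ) (s : X → ℕ) (b : ℕ → 𝕜) (M : Matrix X X 𝕜)
    (E : X → X → ℝ) {C c c' : ℝ} (hb : ∀ j, ‖b j‖ ≤ C) (hc : 0 ≤ c)
    (h179 : ∀ y y', (L ^ (2 * (K - s y)))⁻¹ * ‖M y y'‖ * (L ^ (2 * (K - s y')))⁻¹ ≤ c * E y y')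
    (hrow : ∀ y, ∑ y', E y y' ≤ c') :
    hNormW (sumWeight (fun y => L ^ (K - s y)) (fun y => L ^ (K - s y)))
        (quadratic 𝕜 (Matrix.diagonal fun y => ((L : 𝕜) ^ (3 * (K - s y)))⁻¹ * b (s y) * (L : 𝕜) ^ (K - s y))
          - quadratic 𝕜 (Matrix.of fun y y' =>
              ((L : 𝕜) ^ (3 * (K - s y)))⁻¹ * M y y' * ((L : 𝕜) ^ (3 * (K - s y')))⁻¹))
      ≤ (C + c * c') * Fintype.card X := by
  have hw : ∀ ξ, 0 ≤ sumWeight (fun y => L ^ (K - s y)) (fun y => L ^ (K - s y)) ξ := by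
    intro ξ; unfold sumWeight; cases (ofLex ξ) <;> simp <;> positivity
  rw [sub_eq_add_neg]
  refine (hNormW_add_le hw _ _).trans ?_
  rw [← neg_one_smul 𝕜, hNormW_smul, norm_neg, norm_one, one_mul, add_mul]
  exact add_le_add (eq439 hL K s b hb) (eq441 hL K s M E hc h179 hrow)

end KernelTerms

/-! ## §9 (v1.2) (487) ⟹ (488): LEMMA 20's volumes re-indexed on the small-field regions `Λ^{(j),c}_j` -/

section Volumes

/-- **The volume bookkeeping of (487) ⟹ (488)** — *"We bound the fermion integral `J_{K,Π}` by lemma 20. For `0 ≤ j ≤ K − 1`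
we use `|δΩ^{(j)}_j| ≤ |Ω^{(j),c}_{j+1}| = L³|Ω^{(j+1),c}_{j+1}| ≤ |Λ^{(j+1),c}_{j+1}|`. For `j = K` we use `|δΩ^{(K)}_K| = |Ω^{(K)}_K| ≤
|T⁰_{N−K}| = |Λ^{(K),c}_K|. Hence we have `|J_{K,Π}| ≤ exp(CΣ_{j=1}^{K}|Λ^{(j),c}_j|)`"*: with `a_j = |δΩ^{(j)}_j|` (`0 ≤ j ≤ K`),
`d_j = |δΛ^{(j)}_{j−1}| ≤ b_j` (`δΛ_{j−1} ⊂ Λ^c_j`) and `b_j = |Λ^{(j),c}_j|` (`1 ≤ j ≤ K`, written `j ↦ j + 1` over `range K`),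
LEMMA 20's exponent (449) `CΣ_{j=0}^{K}a_j + Σ_{j=1}^{K}d_j` is at most `(2C + 1)Σ_{j=1}^{K}b_j` (the print's generic `C`
absorbs `2C + 1`; `K ≥ 1`). [cite: Dimock2022UVStabilityQED3, §4.2.2 (487)–(488) p.66 L34–89, esp. L52–62] -/
theorem eq488_volumes {K : ℕ} (hK : 1 ≤ K) {C : ℝ} (hC : 0 ≤ C) (a d b : ℕ → ℝ) (hb : ∀ j, 0 ≤ b j)
    (ha : ∀ j, j < K → a j ≤ b (j + 1)) (haK : a K ≤ b K) (hd : ∀ j, j < K → d (j + 1) ≤ b (j + 1)) :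
    C * ∑ j ∈ range (K + 1), a j + ∑ j ∈ range K, d (j + 1) ≤ (2 * C + 1) * ∑ j ∈ range K, b (j + 1) := by
  set S := ∑ j ∈ range K, b (j + 1) with hS
  have h1 : ∑ j ∈ range K, a j ≤ S := Finset.sum_le_sum fun j hj => ha j (mem_range.mp hj)
  have h2 : b K ≤ S := by
    have hmem : K - 1 ∈ range K := mem_range.mpr (Nat.sub_lt hK Nat.one_pos)
    have := Finset.single_le_sum (f := fun j => b (j + 1)) (fun j _ => hb (j + 1)) hmem
    simpa [Nat.sub_add_cancel hK] using this
  have h3 : ∑ j ∈ range K, d (j + 1) ≤ S := Finset.sum_le_sum fun j hj => hd j (mem_range.mp hj)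
  rw [Finset.sum_range_succ]
  nlinarith [h1, h2, h3, haK]

/-- **(488), the fermion factor**: LEMMA 20 (449) `|J_{K,Π}| ≤ exp(CΣ_{j=0}^{K}|δΩ^{(j)}_j| + Σ_{j=1}^{K}|δΛ^{(j)}_{j−1}|)` and the
inclusions above give *"`|J_{K,Π}| ≤ exp(CΣ_{j=1}^{K}|Λ^{(j),c}_j|)`"* (constant `2C + 1`).
[cite: Dimock2022UVStabilityQED3, §4.2.1 Lemma 20 (449) p.60 L96–113; §4.2.2 (487)–(488) p.66 L52–89] -/
theorem eq488_of_lemma20 {K : ℕ} (hK : 1 ≤ K) {C J : ℝ} (hC : 0 ≤ C) (a d b : ℕ → ℝ) (hb : ∀ j, 0 ≤ b j)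
    (ha : ∀ j, j < K → a j ≤ b (j + 1)) (haK : a K ≤ b K) (hd : ∀ j, j < K → d (j + 1) ≤ b (j + 1))
    (h449 : J ≤ Real.exp (C * ∑ j ∈ range (K + 1), a j + ∑ j ∈ range K, d (j + 1))) :
    J ≤ Real.exp ((2 * C + 1) * ∑ j ∈ range K, b (j + 1)) :=
  h449.trans (Real.exp_le_exp.mpr (eq488_volumes hK hC a d b hb ha haK hd))

end Volumes

/-! ## §10 (v1.3) LEMMA 19 (435) with part B discharged to the basic bound (446) — `QED3BoundaryActivitySum` plugged in -/

section Lemma19From446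

open HGrassmannW QED3BoundaryActivitySum
open Literature.MathematicalPhysics.QuantumFieldTheory.Balaban1983to89.TreeLengthTorus
open Literature.MathematicalPhysics.QuantumFieldTheory.Balaban1983to89.TreeLengthTorusTransfer
open Literature.MathematicalPhysics.QuantumFieldTheory.Balaban1983to89.B12TreeDecay (kappa₀ K₀)
open Literature.MathematicalPhysics.QuantumFieldTheory.Dimock2011to13.Reblocking (doms)

variable {ι : Type*} [LinearOrder ι] [Fintype ι] {w : ι → ℝ} [Fact (∀ ξ : ι, 0 < w ξ)] {d n : ℕ} [NeZero n]

/-- **LEMMA 19 (435) with part B (442)–(448) discharged down to the basic bound (40)∕(446)**: in the multiweight Grassmann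
Banach algebra `(𝒢, ‖·‖_w)` (`w = (I_K, LI_K)`), if `‖S_K‖ ≤ CΣ_j n_j` ((445)), the boundary term is
`B_{K,Π} = Σ_j Σ_{Y ∩ S_j ≠ ∅} B_j(Y)` over the polymers of the cell's torus model meeting the cube sets
`S_j = L^{K−j}δΛ_{j−1}` with activities obeying (446) `‖B_j(Y)‖ ≤ e·exp(−κ d(Y))` (`κ ≥ κ₀(4·2^d,2d)`, `e = e_K^{1∕4−8ε} ≥ 0`),
the cube counts are the printed `|S_j| = M^{−3} m_j` (`m_j = |δΛ^{(j)}_{j−1}|`) and the small factor satisfies `K₀ e ≤ M³`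
(«we throw away the small factor `𝒪(1)e_K^{1∕4−8ε}M^{−3} ≤ 1`», `𝒪(1) = K₀`), then

  `‖exp(−S_K + B_{K,Π})‖_w ≤ exp(CΣ_j n_j + Σ_j m_j)`

— `lemma19` fed with `QED3BoundaryActivitySum.eq448_of_446` (`h448`) and `small_factor_le_one` (`ht`).
[cite: Dimock2022UVStabilityQED3, §4.2.1 Lemma 19 (435) p.59 L22–36; proof part B (442)–(448) p.60 L1–95] -/
theorem lemma19_of_446 (Sact : HGrassmannW 𝕜 ι w) (s : Finset ℕ) (nn m : ℕ → ℝ)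
    (B : ℕ → Finset (TPt d n) → HGrassmannW 𝕜 ι w) (S : ℕ → Finset (TPt d n)) {C e κ M : ℝ}
    (he : 0 ≤ e) (hκ : kappa₀ (4 * 2 ^ d) (2 * d) ≤ κ)
    (h446 : ∀ j ∈ s, ∀ Y ∈ doms d n, ‖B j Y‖ ≤ e * Real.exp (-κ * torusTreeLen Y))
    (hcount : ∀ j ∈ s, ((S j).card : ℝ) = (M ^ 3)⁻¹ * m j) (hm : ∀ j ∈ s, 0 ≤ m j)
    (h445 : ‖Sact‖ ≤ C * ∑ j ∈ s, nn j) (hM : 0 < M) (hsmall : K₀ (4 * 2 ^ d) (2 * d) * e ≤ M ^ 3) :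
    ‖NormedSpace.exp (-Sact + ∑ j ∈ s, ∑ Y ∈ domsMeet (S j), B j Y)‖ ≤
      Real.exp (C * ∑ j ∈ s, nn j + ∑ j ∈ s, m j) :=
  lemma19 Sact _ s nn m hm h445 (eq448_of_446 s B S m he hκ h446 hcount) (small_factor_le_one hM hsmall)

end Lemma19From446

end QED3LargeFieldFermion

end Literature.MathematicalPhysics.QuantumFieldTheory.Dimock2011to13
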